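import Literature.Probability.RandomPlanarGeometry.SAWTurnDensityWindow
import Literature.Probability.RandomPlanarGeometry.SAWLowerBound25
import HarnessLib

/-!
# A turn window for planar self-avoiding walks with standard axioms (memory-one certificate)

Topic `Literature/Probability/RandomPlanarGeometry` (continues `SAWTurnDensityWindow.lean`). The
memory-18 certificates of `SAWTurnDensityWindowZ2.lean` are kernel evaluations (`native_decide`,
axiom `Lean.ofReduceBool`). This file gives the axiom-clean floor of the same statement: the
MEMORY-ONE automaton `nrStep` (remember the last letter, kill an immediate reversal — every
self-avoiding word survives, `run_nrStep_of_isSAW`) carries a two-row turn-tilted Collatz–Wielandt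
certificate checked by `simp`/`ring` (`certificateS_nrStep`: ratio `q + 2p`, tilted growth `1 + 2t`),
whence `Z_n(p/q) ≤ 4q (1 + 2p/q)ⁿ` (`zbendUpper_nr`) and, with the tree's standard-axiom bound
`μ(ℤ²) ≥ 5/2` (`Zd.le_connectiveConstant_two_25`) and the Chernoff transfer:
**`turnWindow_Z2_std : TurnWindow (9/25) (15/16)`** — all but exponentially few `N`-step
self-avoiding walks on `ℤ²` turn at between `36 %` and `93.75 %` of their internal vertices, with
axioms `{propext, Classical.choice, Quot.sound}` only (edge tests `(8/5)²⁵ < (3/10)⁹ (5/2)²⁵`,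
`13¹⁶ < 6¹⁵ (5/2)¹⁶`). The route (a hand-checkable low-memory instance of `CertificateS`) is the
lane planner a-idea-1's R41 proposal.

## References

* N. Madras, G. Slade, *The Self-Avoiding Walk* (1993), Theorem 7.2.3, §1.1–1.2 [MadrasSlade1993].
* A. Pönitz, P. Tittmann, *Improved upper bounds for self-avoiding walks in ℤᵈ*, Electron. J.
  Combin. 7 (2000) R21, §2–3 [PonitzTittmann2000].
-/

noncomputable section

open Finset Literature.Probability.LatticeModels
open scoped BigOperators

namespace Literature.Probability.RandomPlanarGeometry.SAW

namespace FiniteMemory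

/-! ### The memory-one (non-reversal) automaton -/

/-- **The memory-one automaton**: remember the last letter, kill an immediate reversal
(`d = e + 2`). Every self-avoiding word survives; the surviving words are the non-reversing walks
(growth `3`, turn-tilted growth `1 + 2t`). [cite: PonitzTittmann2000, §2 (memory `k = 2`)] -/
def nrStep (a : List Step) (d : Step) : Option (List Step) :=
  match a with
  | [] => some [d]
  | e :: _ => if d = e + 2 then none else some [d]

/-- The last letter of a word as a list of length `≤ 1`. [cite: PonitzTittmann2000, §2] -/
def lastOne (w : List Step) : List Step := w.reverse.take 1

/-- `lastOne (w ++ [d]) = [d]`. [cite: PonitzTittmann2000, §2] -/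
theorem lastOne_append_singleton (w : List Step) (d : Step) : lastOne (w ++ [d]) = [d] := by
  simp [lastOne]

/-- `lastOne w = (lastTwo w).take 1`. [cite: PonitzTittmann2000, §2] -/
theorem lastOne_eq_take_lastTwo (w : List Step) : lastOne w = (lastTwo w).take 1 := by
  rw [lastOne, lastTwo, List.take_take, min_eq_left (by norm_num : 1 ≤ 2)]

/-- Reversal on the step alphabet negates the step vector. [cite: MadrasSlade1993, §1.1] -/
private theorem vec_add_two' (d : Step) : Step.vec (d + 2) = -Step.vec d := by
  ext i
  fin_cases d <;> fin_cases i <;> simp [Step.vec, Step.dx, Step.dy]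

/-- **A self-avoiding word never reverses its last step**: if `w ++ [e] ++ [d]` is self-avoiding then
`d ≠ e + 2`. [cite: MadrasSlade1993, §1.1] -/
theorem ne_rev_of_isSAW {w : List Step} {e d : Step} (h : IsSAW (w ++ [e] ++ [d])) : d ≠ e + 2 := by
  intro hd
  have hinj := (isSAW_iff_injOn _).1 h
  have hlen : (w ++ [e] ++ [d]).length = w.length + 2 := by simp
  have h1 : traj (w ++ [e] ++ [d]) (w.length + 2) = wEnd w + Step.vec e + Step.vec d := by
    rw [show w.length + 2 = (w ++ [e] ++ [d]).length by rw [hlen], traj_length]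
    simp [add_assoc]
  have h2 : traj (w ++ [e] ++ [d]) w.length = wEnd w := by
    rw [List.append_assoc, traj_append_left w ([e] ++ [d]) le_rfl, traj_length]
  have heq : traj (w ++ [e] ++ [d]) (w.length + 2) = traj (w ++ [e] ++ [d]) w.length := by
    rw [h1, h2, hd, vec_add_two', add_assoc, add_neg_cancel, add_zero]
  have := hinj (show w.length + 2 ∈ {j | j ≤ (w ++ [e] ++ [d]).length} by simp)
    (show w.length ∈ {j | j ≤ (w ++ [e] ++ [d]).length} by simp) heq
  omega

/-- **Every self-avoiding word survives the memory-one automaton**, ending in the state `lastOne w`.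
[cite: PonitzTittmann2000, §2] -/
theorem run_nrStep_of_isSAW {w : List Step} (hw : IsSAW w) :
    WordAutomaton.run nrStep w = some (lastOne w) := by
  induction w using List.reverseRecOn with
  | nil => rfl
  | append_singleton w d ih =>
    have hw' : IsSAW w := by simpa using hw.take w.length
    rw [WordAutomaton.run_append_singleton, ih hw', Option.bind_some, lastOne_append_singleton]
    induction w using List.reverseRecOn with
    | nil => rfl
    | append_singleton w' e _ =>
      rw [lastOne_append_singleton, nrStep, if_neg (ne_rev_of_isSAW hw)]

/-- Self-avoiding words are live for `nrStep`. [cite: PonitzTittmann2000, §2] -/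
theorem run_nrStep_ne_none_of_isSAW (w : List Step) (hw : IsSAW w) : WordAutomaton.run nrStep w ≠ none := by
  rw [run_nrStep_of_isSAW hw]; exact Option.some_ne_none _

/-- The turn weight read off the last letter equals the turn weight read off the last two letters
(the turn selector only inspects the most recent letter). [cite: PonitzTittmann2000, §3] -/
theorem patW_zero_lastOne (p q : ℕ) (w : List Step) (d : Step) :
    patW 0 p q (lastOne w) d = if patSel 0 (lastTwo w) d then p else q := by
  rw [patW, lastOne_eq_take_lastTwo]
  cases lastTwo w with
  | nil => rfl
  | cons e r => rfl

/-- **The turn-tilted weight of a self-avoiding word along the memory-one automaton**: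
`wprodS nrStep (patW 0 p q) w = p^{#turns(w)} q^{|w| - #turns(w)}`. [cite: PonitzTittmann2000, §3] -/
theorem wprodS_nrStep_eq (p q : ℕ) {w : List Step} (hw : IsSAW w) :
    WordAutomaton.wprodS nrStep (patW 0 p q) w = p ^ patCount 0 w * q ^ (w.length - patCount 0 w) := by
  induction w using List.reverseRecOn with
  | nil => simp
  | append_singleton w d ih =>
    have hw' : IsSAW w := by simpa using hw.take w.length
    rw [WordAutomaton.wprodS_append_singleton_of_run (run_nrStep_of_isSAW hw'), ih hw', patW_zero_lastOne,
      patCount_append_singleton, List.length_append, List.length_singleton]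
    have hc := patCount_le_length 0 w
    split_ifs with h
    · rw [show w.length + 1 - (patCount 0 w + 1) = w.length - patCount 0 w by omega, pow_succ]; ring
    · rw [add_zero, show w.length + 1 - patCount 0 w = (w.length - patCount 0 w) + 1 by omega, pow_succ]
      ring

/-- The Collatz–Wielandt weight of the memory-one certificate: `v([]) = 4q`, `v([e]) = q + 2p`.
[cite: PonitzTittmann2000, §3] -/
def nrV (p q : ℕ) (a : List Step) : ℕ :=
  match a with
  | [] => 4 * q
  | _ :: _ => q + 2 * p

/-- **The memory-one turn-tilted certificate** (ratio `q + 2p`, i.e. tilted growth `1 + 2t` at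
`t = p/q`; both Collatz–Wielandt rows are equalities). A hand-checkable instance of
`WordAutomaton.CertificateS` with standard axioms. [cite: PonitzTittmann2000, §3] -/
theorem certificateS_nrStep (p q : ℕ) (hq : 1 ≤ q) :
    WordAutomaton.CertificateS nrStep {a | a.length ≤ 1} (nrV p q) (patW 0 p q) (q + 2 * p) 1 := by
  refine ⟨by simp, ?_, ?_, ?_⟩
  · intro a _ d b hb
    cases a with
    | nil => simp only [nrStep, Option.some.injEq] at hb; subst hb; simp
    | cons e r =>
      simp only [nrStep] at hb
      split_ifs at hb
      rw [Option.some.injEq] at hb; subst hb; simp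
  · intro a _
    cases a with
    | nil => simp only [nrV]; omega
    | cons e r => simp only [nrV]; omega
  · intro a ha
    simp only [Set.mem_setOf_eq] at ha
    match a, ha with
    | [], _ =>
      simp [nrStep, patW, patSel, turnSel, lastTwo, nrV]
      ring_nf; exact le_refl _
    | [e], _ =>
      fin_cases e <;> simp [Fin.sum_univ_four, nrStep, patW, patSel, turnSel, lastTwo, nrV] <;> ring_nf <;>
        exact le_refl _

/-- **The turn-tilted count through the memory-one certificate**:
`Σ_{w ∈ sawWords n} p^{#turns} q^{n-#turns} ≤ (q + 2p)ⁿ · 4q` (standard axioms).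
[cite: PonitzTittmann2000, §3] -/
theorem sum_sawWords_patW_le_nr (p q : ℕ) (hq : 1 ≤ q) (n : ℕ) :
    ∑ w ∈ sawWords n, p ^ patCount 0 w * q ^ (n - patCount 0 w) ≤ (q + 2 * p) ^ n * (4 * q) := by
  have h := WordAutomaton.sum_sawWords_wprodS_mul_pow_le (certificateS_nrStep p q hq)
    run_nrStep_ne_none_of_isSAW n
  rw [one_pow, mul_one] at h
  have h2 : ∑ w ∈ sawWords n, p ^ patCount 0 w * q ^ (n - patCount 0 w) =
      ∑ w ∈ sawWords n, WordAutomaton.wprodS nrStep (patW 0 p q) w := by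
    refine sum_congr rfl fun w hw => ?_
    rw [mem_sawWords] at hw
    rw [wprodS_nrStep_eq p q hw.2, hw.1]
  rw [h2]; exact h

/-- **The bending pressure through the memory-one certificate**: `Z_n(p/q) ≤ 4q · (1 + 2p/q)ⁿ`
(standard axioms). [cite: PonitzTittmann2000, §3] -/
theorem zbendUpper_nr (p q : ℕ) (hq : 1 ≤ q) :
    Zd.ZbendUpper ((p : ℝ) / q) (((q : ℝ) + 2 * p) / q) (4 * q) := by
  intro n
  have hq' : (0 : ℝ) < q := by exact_mod_cast hq
  have hqn : (0 : ℝ) < (q : ℝ) ^ n := pow_pos hq' n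
  rw [Zd.Zbend, sum_saws_turns_eq n (fun c => ((p : ℝ) / q) ^ c)]
  have h1 : (∑ w ∈ sawWords n, (p : ℝ) ^ patCount 0 w * (q : ℝ) ^ (n - patCount 0 w)) ≤
      ((q : ℝ) + 2 * p) ^ n * (4 * q) := by exact_mod_cast sum_sawWords_patW_le_nr p q hq n
  have h2 : ∑ w ∈ sawWords n, ((p : ℝ) / q) ^ patCount 0 w =
      (∑ w ∈ sawWords n, (p : ℝ) ^ patCount 0 w * (q : ℝ) ^ (n - patCount 0 w)) / (q : ℝ) ^ n := by
    rw [sum_div]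
    refine sum_congr rfl fun w hw => ?_
    have hc : patCount 0 w ≤ n := by
      rw [mem_sawWords] at hw; rw [← hw.1]; exact patCount_le_length 0 w
    rw [div_pow, div_eq_div_iff (pow_ne_zero _ hq'.ne') hqn.ne', mul_assoc, ← pow_add,
      Nat.sub_add_cancel hc]
  rw [h2, div_le_iff₀ hqn]
  calc _ ≤ ((q : ℝ) + 2 * p) ^ n * (4 * q) := h1
    _ = 4 * (q : ℝ) * (((q : ℝ) + 2 * p) / q) ^ n * (q : ℝ) ^ n := by
        rw [div_pow]; field_simp

end FiniteMemory

namespace Zd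

/-! ### The standard-axiom edges and window -/

/-- LOWER turn edge from the memory-one certificate at `t = 3/10` (growth `8/5`), any `μlo`:
`TurnsLower a ((8/5)/((3/10)^a μlo)) (40·(3/10)^a)`. [cite: MadrasSlade1993, Theorem 7.2.3 (shape); PonitzTittmann2000, §3] -/
theorem turnsLower_nr_of_le {μlo : ℝ} (hμ0 : 0 < μlo) (hμ : μlo ≤ connectiveConstant 2) (a : ℝ) :
    TurnsLower a ((8 / 5) / ((3 / 10 : ℝ) ^ a * μlo)) (40 * (3 / 10 : ℝ) ^ a) := by
  have h := FiniteMemory.zbendUpper_nr 3 10 (by norm_num)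
  norm_num at h
  exact chernoffLower _ _ _ a μlo (by norm_num) (by norm_num) (by norm_num) hμ0 hμ h

/-- UPPER turn edge from the memory-one certificate at `t = 6` (growth `13`), any `μlo`:
`TurnsUpper b (13/(6^b μlo)) (4·6^b)`. [cite: MadrasSlade1993, Theorem 7.2.3 (shape); PonitzTittmann2000, §3] -/
theorem turnsUpper_nr_of_le {μlo : ℝ} (hμ0 : 0 < μlo) (hμ : μlo ≤ connectiveConstant 2) (b : ℝ) :
    TurnsUpper b (13 / ((6 : ℝ) ^ b * μlo)) (4 * (6 : ℝ) ^ b) := by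
  have h := FiniteMemory.zbendUpper_nr 6 1 (by norm_num)
  norm_num at h
  exact chernoffUpper _ _ _ b μlo (by norm_num) (by norm_num) hμ0 hμ h

/-- **Turn window with STANDARD axioms** (memory-one certificate + `μ(ℤ²) ≥ 5/2`,
`Zd.le_connectiveConstant_two_25`): all but exponentially few `N`-step self-avoiding walks on `ℤ²`
turn at between `36 %` and `15/16` of their internal vertices — `TurnWindow (9/25) (15/16)`; no
`native_decide` anywhere in its closure (the memory-18 edition `turnWindow_Z2` gives `[0.48, 0.73]`).
[cite: MadrasSlade1993, Theorem 7.2.3 (explicit two-sided instance); PonitzTittmann2000, §3] -/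
theorem turnWindow_Z2_std : TurnWindow (9 / 25) (15 / 16) := by
  have hμ := Zd.le_connectiveConstant_two_25
  have h₁ := turnsLower_nr_of_le (by norm_num : (0 : ℝ) < 5 / 2) hμ ((9 : ℕ) / (25 : ℕ) : ℝ)
  have h₂ := turnsUpper_nr_of_le (by norm_num : (0 : ℝ) < 5 / 2) hμ ((15 : ℕ) / (16 : ℕ) : ℝ)
  have e₁ : ((9 : ℕ) / (25 : ℕ) : ℝ) = 9 / 25 := by norm_num
  have e₂ : ((15 : ℕ) / (16 : ℕ) : ℝ) = 15 / 16 := by norm_num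
  have hθ₁ := theta_lt_one (Λ := 8 / 5) (t := 3 / 10) (μlo := 5 / 2) (m := 9) (n := 25)
    (by norm_num) (by norm_num) (by norm_num) (by norm_num)
  have hθ₂ := theta_lt_one (Λ := 13) (t := 6) (μlo := 5 / 2) (m := 15) (n := 16)
    (by norm_num) (by norm_num) (by norm_num) (by norm_num)
  rw [e₁] at h₁ hθ₁; rw [e₂] at h₂ hθ₂
  exact turnWindow_of_edges h₁ h₂ (by positivity) hθ₁ (by positivity) hθ₂ (by positivity) (by positivity)

end Zd

end Literature.Probability.RandomPlanarGeometry.SAW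
end
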